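import Summits.BirchSwinnertonDyer.Rank1Residual.AdditivePotMult.ClassTheorems
import Summits.BirchSwinnertonDyer.Rank1Residual.Additive.QuadraticTwistTypeGOrd
import Summits.BirchSwinnertonDyer.Rank1Residual.Additive.QuadraticTwistBigIm
import Summits.BirchSwinnertonDyer.Rank1Residual.Partition.Bsdp
import Summits.BirchSwinnertonDyer.Rank1Residual.X9.SurjBigImage
import Literature.NumberTheory.EllipticCurves.ComplexMultiplicationHasCMProofs
import Literature.NumberTheory.EllipticCurves.Rank1Residual.Typed.X1
import HarnessLib

/-!
# X3♯(G-ord) / X4♯(G-ord), defect 2: BASE-CHANGE-AND-DESCEND — the class theorems and the exact map of what converts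

HONEST FRAMING (cell `b2b-bsdres`, run/shared/lean/b2b/bsd-rank1-residual/, verbatim in every
file): the goal of the cell is to DELETE the COMBINATION-SHAPED residual classes of the
Birch–Swinnerton-Dyer formula for ALL analytic-rank `≤ 1` elliptic curves over `ℚ` — "full BSD
formula for every rank `≤ 1` curve in class `C`" assembled STRICTLY from published theorems — so
that the rank-`≤ 1` remainder becomes exactly the CONSTRUCTION-SHAPED classes, which are TYPED
(missing-input `Prop`s), NOT attempted. This is not "finishing BSD". Sub-cell `additive-p2`
(human GO 2026-08-19T21:53Z part 3, CLASS-OWNERS row "X3/X4 additive — pot. good ordinary /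
X3♯(G-ord)"; "p1 writes `Descent.lean`, p2 imports"): a RESEARCH ROUTE; no claim beyond the stated
sub-classes; X3♯(G-ord) and X4♯(G-ord) REMAIN CONSTRUCTION-SHAPED. Theorems only; no named fact.

## The route (semistability defect 2 = Kodaira `I₀*`; 681 of the 1280 census pairs of
## X3♯(G-ord) ∪ X4♯(G-ord), N < 2·10⁴, among them ALL 421 sub-class pairs at `p = 3`)

`(E, p)` additive with `E^{(p*)}` GOOD ORDINARY at `p` (`p* = (−1)^{(p−1)/2} p`; then
`(E, p) ∈ X3♯(G-ord)/X4♯(G-ord)`, sibling `QuadraticTwistTypeGOrd.lean`). Over `K = ℚ(√p*)`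
(`d_K = p*`, the prime `𝔭` over `p` ramified, `𝔭² = (p)`) the curves `E_K ≅ E^{(p*)}_K` have GOOD
ORDINARY reduction at `𝔭`. Artin formalism and Milne's Weil-restriction theorem give the kernel
DESCENT THEOREM of sub-cell additive-p1 (`AdditivePotMult.bsdp_of_pPartOver_of_bsdp_twist'`, any
quadratic `K`, any `p`): `BSD(E,p) ⇐ MissingPPartOverAt(E_K, p) ∧ BSD(E^{(d_K)}, p)`, `E`,
`E^{(d_K)}` of analytic rank `≤ 1`. Here the twist pair `(E^{(p*)}, p)` sits at a GOOD ORDINARY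
prime, where the partition lemma of the cell (`Partition.lean`, `partition`) leaves exactly the
cells below. THIS FILE PROVES, in the kernel, the map "sub-population ↦ what its `BSD_p` reduces to":

| sub-population of X3♯/X4♯(G-ord), e = 2 (hypotheses on the pair) | twist pair `(E^{(p*)}, p)` is | `BSD(E,p)` ⇐ | theorem |
|---|---|---|---|
| any, twist pair Covered (rows C1–C17 of RESIDUAL-CASES §a.1) | Covered | `MissingPPartOverAt(E_K,p)` ALONE (+ the 14 row facts, Milne, GZK, modularity) | `bsdp_of_pPartOver_of_covered_twist` |
| X4, `p > 3`, non-CM, (im) for `E` [⇐ surj(p), `p ≥ 5`] | row C2 (BCS 2025 Cor. 1.3.1) | `MissingPPartOverAt(E_K,p)` ALONE (+ BCS, Milne, GZK, modularity) | `bsdp_of_classX4_of_goodOrd_twist`, `…_of_surj` |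
| X4, `p = 3`, surj(3) or ram(3) FOR THE TWIST | row C16 (Yan–Zhu 2026 @3) | `MissingPPartOverAt(E_K,3)` ALONE (+ YZ, Wuthrich L20, Milne, GZK, mod.) | `bsdp_three_of_classX4_of_goodOrd_twist` |
| X4, `p ≥ 5`, ¬surj(p) | class X9 (= X9im) of the twist | over-`K` + X9's typed input | `covered_or_cases_of_goodOrd_twist` (map only) |
| X4, `p = 3`, neither | class X10 of the twist | over-`K` + X10's typed input | (map only) |
| X3, twist pair NOT anomalous | row C6 (CGS 2025 Thm. D) | `MissingPPartOverAt(E_K,p)` ALONE (+ CGS, GV chain, Milne, GZK, mod.) | `bsdp_of_classX3_of_goodOrd_twist_of_not_anom` |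
| X3, twist `r = 0`, non-CM, GV parity | row C7 (GV 2000 + Greenberg) | `MissingPPartOverAt(E_K,p)` ALONE (+ GV chain, Milne, GZK, mod.) | `bsdp_of_classX3_of_goodOrd_twist_of_gvPar` |
| X3, otherwise (twist pair anomalous, off C7) | class X1 of the twist | over-`K` + `Typed.X1.MissingInputAt` (twist) | `bsdp_of_classX3_of_goodOrd_twist_of_classX1`, `covered_or_classX1_twist_of_classX3` |

(CM pairs: the twist is CM with good reduction at odd `p`, rows C8/C10 — Covered; recorded in
`covered_or_cases_of_goodOrd_twist`.) Hypothesis (im) is placed on `E` itself thanks to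
`bigIm_iff_of_model_twist_pStar` (`QuadraticTwistBigIm.lean`: `√p* ∈ ℚ(μ_p)`), and irreducibility /
non-CM pass to the twist (`AdditivePotMult.irr_iff_of_model_twist`, `hasCM_iff_of_j_eq`).

## What is converted and what is NOT (the located gap — unchanged, HOME/b2b-bsdres-additive-p2/AUDIT-X34-GORD.md)

Every theorem RELOCATES the missing input of the pair to `AdditivePotMult.MissingPPartOverAt W' p`
— the `p`-part of BSD, in Miller's currency, for ONE curve `E_K` over ONE quadratic field
`K = ℚ(√p*)` at its prime `𝔭 ∣ p` of GOOD ORDINARY reduction and RAMIFICATION INDEX 2 (`K` real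
for `p ≡ 1 (mod 4)`, imaginary for `p ≡ 3 (mod 4)`). No published theorem reaches it (presearch of
gen 0 and additive-p1, corpus fts + vec + galaxy, re-checked 2026-08-19): Wan, Forum Math. Sigma 3
(2015) §1.1 / Thm. 7 / Thm. 101 ("F a totally real number field where p is unramified"; only one
divisibility over `F ≠ ℚ`, p. 4); Burungale–Castella–Skinner IMRN 2025 §2.1 (ur) "`p ∤ D_F`";
Corpuz–Delbourgo, J. Number Theory 279 (2026) (p unramified in F); Disegni, ANT 9 (2015) Thm. 3
(conditional on the cyclotomic IMC over `F`); Heegner/BDP-type results over imaginary quadratic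
`K` need `p` SPLIT; Skinner–Urban 2014 Thm. 3.6.4 / BCS Cor. 1.3.1 live over `ℚ` (the
`ℤ_p`-cyclotomic branch). Equivalently over `ℚ` (Delbourgo, Compositio 113 (1998) (G), Main
Conjecture p. 151, OPEN): the `ω^{(p−1)/2}`-branch of the cyclotomic main conjecture of `E^{(p*)}`
over `ℚ(μ_{p^∞})` (Kato Thm. 17.4 gives the Euler-system half on every branch; the Eisenstein half is
printed only on the trivial branch). So NOTHING is deleted: on the rows marked "ALONE" the ENTIRE
residue of the pair is that one over-`K` statement; elsewhere it is that statement AND the typed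
input of the twist's own residual class. Both sub-classes stay CONSTRUCTION-SHAPED.

References: J. S. Milne, Invent. Math. 17 (1972) Thm. 1; T. & V. Dokchitser, Ann. of Math. 172
(2010) §2.1; A. Burungale, F. Castella, C. Skinner, IMRN 2025 Cor. 1.3.1; F. Castella, G. Grossi,
C. Skinner, Math. Ann. 393 (2025) Thm. D; R. Greenberg, V. Vatsal, Invent. Math. 142 (2000) Thm. 1.3;
X. Yan, X. Zhu, J. Algebra 693 (2026) Thm. 4.15; C. Wuthrich, LMS LNS 414 (2014) Lemma 20, Prop. 21;
D. Delbourgo, Compositio Math. 113 (1998) §1.5, p. 151; X. Wan, Forum Math. Sigma 3 (2015) e18 §1.1;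
J. H. Silverman, AEC VII.5, X.5.4; RESIDUAL-CASES.md §a.1–§a.2; HOME/PARTITION.md.
-/

noncomputable section

open scoped Classical

open WeierstrassCurve Literature.NumberTheory.EllipticCurves
  Literature.NumberTheory.EllipticCurves.Rank1Residual
  Literature.NumberTheory.EllipticCurves.Rank1Residual.Typed
  Literature.NumberTheory.EllipticCurves.ModularForms
  Literature.NumberTheory.EllipticCurves.Wuthrich2014
  Summit.BirchSwinnertonDyer.Rank1Residual.AdditivePotMult

namespace Summit.BirchSwinnertonDyer.Rank1Residual.Additive

variable (W : WeierstrassCurve ℚ) [W.IsElliptic] [W.IsGloballyMinimal] (p : ℕ) [hp : Fact p.Prime]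
  (K : Type) [Field K] [NumberField K]
  (Wd : WeierstrassCurve ℚ) [Wd.IsElliptic] [Wd.IsGloballyMinimal]
  (W' : WeierstrassCurve K) [W'.IsElliptic] [W'.IsGloballyMinimal]

/-! ## §1 Over-`K` input + a COVERED twist pair ⇒ `BSD(E,p)` (any prime, any quadratic `K`) -/

/-- **Base-change-and-descend with a Covered twist.** Let `W/ℚ` be globally minimal of analytic
rank `≤ 1`, `K` a quadratic field, `Wd` a globally minimal model of `W^{(d_K)}` of analytic rank
`≤ 1` whose pair `(Wd, p)` lies in a COVERED row of the partition (`Covered Wd p`: rows C1, C2, C3,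
C6, C7, C8, C10, C16, C17 of RESIDUAL-CASES §a.1, hypotheses as the tree states them), and `W'` a
globally minimal `K`-model of `W_K`. Then the typed over-`K` input `MissingPPartOverAt W' p` ALONE
gives Miller's `BSD(W,p)` — granted the fourteen named PUBLISHED facts of the covered rows
(`bsdp_of_covered`), Milne 1972 (`hMilne`), Gross–Zagier–Kolyvagin (`hGZK`), modularity (`hmod`,
`hmodP`). Composition of additive-p1's descent theorem with the partition's `bsdp_of_covered`. -/
theorem bsdp_of_pPartOver_of_covered_twist (hSk : Skinner2016.thmC_padicValRat_bsd_rank_zero)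
    (hBCS : BurungaleCastellaSkinner2025.cor131_padicValRat_bsd_rank_le_one)
    (hJSW : JetchevSkinnerWan2017.thm121_padicValRat_bsd_rank_one)
    (hCGS : CastellaGrossiSkinner2025.thmD_padicValRat_bsd_rank_le_one)
    (hGV : GreenbergVatsal2000.thm13_charIdeal_eq_of_gvPar) (hGr : greenberg_charValue_rankZero)
    (hmod : hasEntireLFunction_rat) (hmodP : nonempty_modularParametrizationData)
    (hGZK : rank_eq_analyticRank_of_analyticRank_le_one)
    (hCM : bsdTriple_of_hasCM_of_L_one_ne_zero) (hKob : Kobayashi2013.cor14_bsdp_of_cm_rank_one)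
    (hYZ : YanZhu2026.thm415_padicValRat_bsd_rank_le_one)
    (hW20 : Wuthrich2014.lemma20_surjective_threeAdic_of_semistable)
    (hLLT : LiLiuTian2024.thm11_bsdp_of_cm_rank_one)
    (hMilne : Milne1972.bsdQuotient_baseChange_quadratic)
    (hr : W.analyticRank ≤ 1) (h2 : Module.finrank ℚ K = 2)
    (hWd : ∃ C : VariableChange ℚ, C • W.quadraticTwist (NumberField.discr K : ℚ) = Wd)
    (hrd : Wd.analyticRank ≤ 1) (hcov : Covered Wd p)
    (hW' : ∃ C : VariableChange K, C • W.baseChange K = W') (hK : MissingPPartOverAt W' p) :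
    BSDp W p :=
  bsdp_of_pPartOver_of_bsdp_twist' W p K Wd W' hGZK hmod hMilne hr h2 hWd hrd hW' hK
    (bsdp_of_covered hSk hBCS hJSW hCGS hGV hGr hmod hmodP hGZK hCM hKob hYZ hW20 hLLT hrd hcov)

/-! ## §2 Where a GOOD ORDINARY twist pair can sit in the partition -/

omit [W.IsElliptic] [W.IsGloballyMinimal] in
/-- **At a good ordinary odd prime the residual classes shrink to X1, X9, X9im, X10, X12.** For a
pair `(V, p)` with `p ≠ 2` and `GoodOrd V p`: if it is Residual (tree X1–X12, X9im, X11a, X11b) then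
it is an X1, X9, X9im, X10 or X12 pair — X2/X11/X11a/X11b need a multiplicative `p`, X3/X4 an
additive `p`, X5 `p = 2`, X6/X7/X8 a supersingular `p`. Pure bookkeeping on the tree's predicates. -/
theorem residual_cases_of_goodOrd {V : WeierstrassCurve ℚ} [V.IsElliptic] [V.IsGloballyMinimal]
    (hp2 : p ≠ 2) (hord : GoodOrd V p) (hres : Residual V p) :
    ClassX1 V p ∨ ClassX9 V p ∨ ClassX9im V p ∨ ClassX10 V p ∨ ClassX12 V p := by
  have hgood : Good V p := hord.1
  have hnm : ¬ Mult V p := not_mult_of_good V p hgood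
  have hnss : ¬ GoodSS V p := fun h => hord.2 h.2
  rcases hres with h | h | h | h | h | h | h | h | h | h | h | h | h | h | h
  · exact Or.inl h
  · exact absurd h.2.2 hnm
  · exact absurd hgood h.2.1
  · exact absurd hgood h.2.1.1
  · exact absurd h hp2
  · exact absurd h.1 hnss
  · exact absurd h.1 hnss
  · obtain ⟨rfl, hss, -⟩ := h
    exact absurd hss hnss
  · exact Or.inr (Or.inl h)
  · exact Or.inr (Or.inr (Or.inr (Or.inl h)))
  · exact absurd h.1 hnm
  · exact Or.inr (Or.inr (Or.inr (Or.inr h)))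
  · exact Or.inr (Or.inr (Or.inl h))
  · exact absurd h.2.2.1 hnm
  · exact absurd h.2.2.1 hnm

omit [W.IsElliptic] [W.IsGloballyMinimal] in
/-- **The map, coarse form.** A good ordinary pair `(Wd, p)`, `p` odd, of analytic rank `≤ 1` — e.g.
the twist pair `(E^{(p*)}, p)` of an X3♯/X4♯(G-ord) pair of defect 2 — is COVERED or lies in class
X1, X9, X9im, X10 or X12 (the cell's partition lemma `partition` + `residual_cases_of_goodOrd`). -/
theorem covered_or_cases_of_goodOrd_twist (hp2 : p ≠ 2) (hord : GoodOrd Wd p)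
    (hrd : Wd.analyticRank ≤ 1) :
    Covered Wd p ∨ ClassX1 Wd p ∨ ClassX9 Wd p ∨ ClassX9im Wd p ∨ ClassX10 Wd p ∨ ClassX12 Wd p :=
  (partition hrd).imp_right (residual_cases_of_goodOrd p hp2 hord)

/-! ## §3 Invariants of the twist by `p*`: CM, irreducibility, (im) -/

omit [W.IsElliptic] [W.IsGloballyMinimal] in
/-- `p* = (−1)^{⌊p/2⌋} p ≠ 0`. -/
theorem pStar_ne_zero : ((-1 : ℚ) ^ (p / 2) * p) ≠ 0 :=
  mul_ne_zero (pow_ne_zero _ (by norm_num)) (by exact_mod_cast hp.out.ne_zero)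

section Invariants

variable {W p Wd}

omit [W.IsGloballyMinimal] [Wd.IsGloballyMinimal] in
/-- CM is a property of the `ℚ̄`-isomorphism class, so of the `j`-invariant: a `ℚ`-model `Wd` of a
quadratic twist `W^{(d)}` has CM iff `W` has (`j(W^{(d)}) = j(W)`, `j_quadraticTwist`;
`hasCM_iff_of_j_eq`). -/
theorem hasCM_iff_of_model_twist {d : ℚ} (hd : d ≠ 0)
    (hWd : ∃ C : VariableChange ℚ, C • W.quadraticTwist d = Wd) : Wd.HasCM ↔ W.HasCM := by
  obtain ⟨C, rfl⟩ := hWd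
  haveI := W.isElliptic_quadraticTwist hd
  apply hasCM_iff_of_j_eq
  rw [variableChange_j, j_quadraticTwist W hd]

end Invariants

/-! ## §4 X4♯(G-ord), defect 2: the twist pair is row C2 (`p > 3`) / row C16 (`p = 3`) -/

omit [W.IsGloballyMinimal] [Wd.IsGloballyMinimal] in
/-- **X4 ↦ row C2 for the twist.** For `(E,p) ∈ X4` (`p` odd, additive, `E[p]` irreducible) with
`E` non-CM, `p > 3`, hypothesis (im) for `E`, and a `ℚ`-model `Wd` of `E^{(p*)}` that is good
ordinary at `p` (as stated on the globally minimal model), the twist pair `(Wd, p)` satisfies the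
hypotheses of Burungale–Castella–Skinner 2025 Cor. 1.3.1 (row C2): non-CM (`hasCM_iff_of_model_twist`),
`p > 3`, good ordinary, irreducible (`irr_iff_of_model_twist`), (im) (`bigIm_iff_of_model_twist_pStar`).
[cite: BurungaleCastellaSkinner2025, Cor. 1.3.1 (p. 4) and (im) (p. 2)] -/
theorem rowC2_twist_of_classX4 [Wd.IsGloballyMinimal] (hX : ClassX4 W p) (hcm : ¬ W.HasCM)
    (hp3 : 3 < p) (him : BigIm W p)
    (hWd : ∃ C : VariableChange ℚ, C • W.quadraticTwist ((-1 : ℚ) ^ (p / 2) * p) = Wd)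
    (hord : GoodOrd Wd p) : RowC2 Wd p :=
  ⟨fun h => hcm ((hasCM_iff_of_model_twist (pStar_ne_zero p) hWd).mp h), hp3, hord,
    (irr_iff_of_model_twist (pStar_ne_zero p) hWd).mpr hX.2.2,
    (bigIm_iff_of_model_twist_pStar W p hX.1 hWd).mpr him⟩

/-- **X4♯(G-ord), defect 2, `p > 3` — the sharpest conversion.** For `(E, p) ∈ X4` with `E` non-CM
of analytic rank `≤ 1`, `p > 3`, hypothesis (im) for `E` (for `p ≥ 5` implied by surj(p), see
`bsdp_of_classX4_of_goodOrd_twist_of_surj`), `K` THE quadratic field of discriminant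
`p* = (−1)^{(p−1)/2} p` (i.e. `K = ℚ(√p*) ⊆ ℚ(ζ_p)`), `Wd` a globally minimal model of `E^{(p*)}`
that is GOOD ORDINARY at `p` (so `(E,p) ∈ X4♯(G-ord)`, `classX4Gord_of_goodOrd_quadraticTwist`) of
analytic rank `≤ 1`, and `W'` a globally minimal `K`-model of `E_K`: **`BSD(E,p)` follows from the
typed over-`K` input `MissingPPartOverAt W' p` ALONE**, the other inputs being PUBLISHED theorems
taken as the cell's named facts — Burungale–Castella–Skinner 2025 Cor. 1.3.1 for the twist pair
(row C2, `hBCS`), Milne 1972 (`hMilne`), Gross–Zagier–Kolyvagin (`hGZK`), modularity (`hmod`). The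
over-`K` input is the `p`-part of BSD for `E_K` at the ramified prime `𝔭`, `𝔭² = (p)`, of GOOD
ORDINARY reduction — reached by no published theorem (module docstring). Nothing asserts
`r_an(E^{(p*)}) ≤ 1` for a given pair: it is a census bit (HOME report).
[cite: BurungaleCastellaSkinner2025, Cor. 1.3.1 (p. 4)] -/
theorem bsdp_of_classX4_of_goodOrd_twist
    (hGZK : rank_eq_analyticRank_of_analyticRank_le_one) (hmod : hasEntireLFunction_rat)
    (hMilne : Milne1972.bsdQuotient_baseChange_quadratic)
    (hBCS : BurungaleCastellaSkinner2025.cor131_padicValRat_bsd_rank_le_one)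
    (hX : ClassX4 W p) (hcm : ¬ W.HasCM) (hp3 : 3 < p) (him : BigIm W p) (hr : W.analyticRank ≤ 1)
    (h2 : Module.finrank ℚ K = 2) (hdK : (NumberField.discr K : ℚ) = (-1 : ℚ) ^ (p / 2) * p)
    (hWd : ∃ C : VariableChange ℚ, C • W.quadraticTwist (NumberField.discr K : ℚ) = Wd)
    (hord : GoodOrd Wd p) (hrd : Wd.analyticRank ≤ 1)
    (hW' : ∃ C : VariableChange K, C • W.baseChange K = W') (hK : MissingPPartOverAt W' p) :
    BSDp W p := by
  have hWd' : ∃ C : VariableChange ℚ, C • W.quadraticTwist ((-1 : ℚ) ^ (p / 2) * p) = Wd := by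
    rw [← hdK]; exact hWd
  have hC2 : RowC2 Wd p := rowC2_twist_of_classX4 W p Wd hX hcm hp3 him hWd' hord
  have hd : BSDp Wd p := RowC2.bsdp hBCS hGZK hrd hC2
  exact bsdp_of_pPartOver_of_bsdp_twist' W p K Wd W' hGZK hmod hMilne hr h2 hWd hrd hW' hK hd

/-- **X4♯(G-ord), defect 2, `p ≥ 5`, surjective `ρ̄_{E,p}`**: as `bsdp_of_classX4_of_goodOrd_twist`,
with (im) for `E` DISCHARGED from surj(p) by the x9 seat's kernel theorem `X9.bigIm_of_surj`
(`p ≥ 5`). On this sub-population (X4 ∧ surj ∧ `p ≥ 5` ∧ `I₀*` with good ORDINARY twist ∧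
`r_an(E^{(p*)}) ≤ 1`) `BSD(E,p)` is EXACTLY the over-`K` statement `MissingPPartOverAt W' p`.
[cite: BurungaleCastellaSkinner2025, Cor. 1.3.1 (p. 4)] -/
theorem bsdp_of_classX4_of_goodOrd_twist_of_surj
    (hGZK : rank_eq_analyticRank_of_analyticRank_le_one) (hmod : hasEntireLFunction_rat)
    (hMilne : Milne1972.bsdQuotient_baseChange_quadratic)
    (hBCS : BurungaleCastellaSkinner2025.cor131_padicValRat_bsd_rank_le_one)
    (hX : ClassX4 W p) (hcm : ¬ W.HasCM) (hp5 : 5 ≤ p) (hsurj : Surj W p) (hr : W.analyticRank ≤ 1)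
    (h2 : Module.finrank ℚ K = 2) (hdK : (NumberField.discr K : ℚ) = (-1 : ℚ) ^ (p / 2) * p)
    (hWd : ∃ C : VariableChange ℚ, C • W.quadraticTwist (NumberField.discr K : ℚ) = Wd)
    (hord : GoodOrd Wd p) (hrd : Wd.analyticRank ≤ 1)
    (hW' : ∃ C : VariableChange K, C • W.baseChange K = W') (hK : MissingPPartOverAt W' p) :
    BSDp W p :=
  bsdp_of_classX4_of_goodOrd_twist W p K Wd W' hGZK hmod hMilne hBCS hX hcm (by omega)
    (X9.bigIm_of_surj W p hp5 hsurj) hr h2 hdK hWd hord hrd hW' hK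

/-- **X4♯(G-ord) at `p = 3`** (all 151 census pairs of X4♯(G-ord) at `3` are of type `I₀*`): for
`(E, 3) ∈ X4` of analytic rank `≤ 1`, `K = ℚ(√−3)` (`d_K = −3 = 3*`), `Wd` a globally minimal
model of `E^{(−3)}` GOOD ORDINARY at `3` of analytic rank `≤ 1` with surj(3) OR ram(3) FOR THE TWIST
(row C16: Yan–Zhu 2026 Thm. 4.15 at `p = 3`, (Im) from Wuthrich 2014 Lemma 20 or from the ramified
multiplicative prime), and `W'` a globally minimal `K`-model of `E_K`: `BSD(E,3)` follows from
`MissingPPartOverAt W' 3` ALONE (+ YZ `hYZ`, Wuthrich L20 `hW20`, Milne, GZK, modularity). Otherwise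
the twist pair is an X10 pair (`covered_or_cases_of_goodOrd_twist`). Irreducibility of `E^{(−3)}[3]`
comes from `E` (`irr_iff_of_model_twist`). [cite: YanZhu2024MainConjNonCM, Thm. 4.15 (§4.6)]
[cite: Wuthrich2014, Lemma 20 (p. 399)] -/
theorem bsdp_three_of_classX4_of_goodOrd_twist [Fact (3 : ℕ).Prime] (W'₃ : WeierstrassCurve K)
    [W'₃.IsElliptic] [W'₃.IsGloballyMinimal]
    (hGZK : rank_eq_analyticRank_of_analyticRank_le_one) (hmod : hasEntireLFunction_rat)
    (hMilne : Milne1972.bsdQuotient_baseChange_quadratic)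
    (hYZ : YanZhu2026.thm415_padicValRat_bsd_rank_le_one)
    (hW20 : Wuthrich2014.lemma20_surjective_threeAdic_of_semistable)
    (hX : ClassX4 W 3) (hr : W.analyticRank ≤ 1)
    (h2 : Module.finrank ℚ K = 2) (hdK : (NumberField.discr K : ℚ) = -3)
    (hWd : ∃ C : VariableChange ℚ, C • W.quadraticTwist (NumberField.discr K : ℚ) = Wd)
    (hord : GoodOrd Wd 3) (h16 : Surj Wd 3 ∨ Ram Wd 3) (hrd : Wd.analyticRank ≤ 1)
    (hW' : ∃ C : VariableChange K, C • W.baseChange K = W'₃) (hK : MissingPPartOverAt W'₃ 3) :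
    BSDp W 3 := by
  have hd3 : (NumberField.discr K : ℚ) ≠ 0 := by rw [hdK]; norm_num
  have hirr : Irr Wd 3 := (irr_iff_of_model_twist hd3 hWd).mpr hX.2.2
  have hC16 : RowC16 Wd 3 := ⟨rfl, hord, hirr, h16⟩
  have hd : BSDp Wd 3 := RowC16.bsdp hYZ hW20 hmod hGZK hrd hC16
  exact bsdp_of_pPartOver_of_bsdp_twist' W 3 K Wd W'₃ hGZK hmod hMilne hr h2 hWd hrd hW' hK hd

/-! ## §5 X3♯(G-ord), defect 2: the twist pair is Eisenstein at a GOOD ordinary prime -/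

omit [W.IsGloballyMinimal] in
/-- **X3 ↦ (red, good ordinary) for the twist.** For `(E,p) ∈ X3` (additive Eisenstein `p`) and a
globally minimal model `Wd` of `E^{(p*)}` good ordinary at `p`: `E^{(p*)}[p]` is reducible
(`red_of_model_twist`) and `p` is a good ordinary prime of `E^{(p*)}` — the domain of rows C6
(non-anomalous), C7 (rank 0, GV parity) and of class X1. -/
theorem red_goodOrd_twist_of_classX3 (hX : ClassX3 W p)
    (hWd : ∃ C : VariableChange ℚ, C • W.quadraticTwist ((-1 : ℚ) ^ (p / 2) * p) = Wd)
    (hord : GoodOrd Wd p) : Red Wd p ∧ GoodOrd Wd p :=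
  ⟨red_of_model_twist (pStar_ne_zero p) hWd hX.1, hord⟩

omit [W.IsGloballyMinimal] in
/-- **The map for X3♯(G-ord), defect 2: the twist pair is COVERED or an X1 pair.** For
`(E,p) ∈ X3`, `p` odd, and a globally minimal `Wd ≅ E^{(p*)}` good ordinary at `p` of analytic rank
`≤ 1`: either `(Wd, p)` is Covered — CM twist (rows C8/C10), non-anomalous (row C6, CGS 2025
Thm. D), or rank `0` with the Greenberg–Vatsal parity condition (row C7) — or `(Wd, p)` is a class-X1
pair (odd good anomalous Eisenstein prime off the C7 cell). Decided by the tree's predicates alone. -/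
theorem covered_or_classX1_twist_of_classX3 (hp2 : p ≠ 2) (hX : ClassX3 W p)
    (hWd : ∃ C : VariableChange ℚ, C • W.quadraticTwist ((-1 : ℚ) ^ (p / 2) * p) = Wd)
    (hord : GoodOrd Wd p) (hrd : Wd.analyticRank ≤ 1) : Covered Wd p ∨ ClassX1 Wd p := by
  have hp2' : 2 < p := by
    have := hp.out.two_le
    omega
  obtain ⟨hred, -⟩ := red_goodOrd_twist_of_classX3 W p Wd hX hWd hord
  by_cases hcm : Wd.HasCM
  · left
    rcases Nat.le_one_iff_eq_zero_or_eq_one.mp hrd with h0 | h1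
    · exact Or.inr (Or.inr (Or.inr (Or.inr (Or.inr (Or.inl ⟨hcm, h0⟩)))))
    · exact Or.inr (Or.inr (Or.inr (Or.inr (Or.inr (Or.inr (Or.inl ⟨hcm, h1, hp2, hord.1⟩))))))
  by_cases han : Anom Wd p
  · by_cases hgv : Wd.analyticRank = 0 ∧ GVPar Wd p
    · left
      exact Or.inr (Or.inr (Or.inr (Or.inr (Or.inl ⟨hgv.1, hcm, hp2, hord, hred, hgv.2⟩))))
    · right
      exact ⟨hp2', hred, hord.1, han, hgv⟩
  · left
    exact Or.inr (Or.inr (Or.inr (Or.inl ⟨hp2', hred, hord.1, han⟩)))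

/-- **X3♯(G-ord), defect 2, twist pair NOT anomalous — conversion to the over-`K` input ALONE.**
For `(E,p) ∈ X3` of analytic rank `≤ 1`, `p` odd, `K = ℚ(√p*)`, `Wd` a globally minimal model of
`E^{(p*)}` GOOD ORDINARY at `p` of analytic rank `≤ 1` with `a_p(E^{(p*)}) ≢ 1 (mod p)` (`¬ Anom`),
and `W'` a globally minimal `K`-model of `E_K`: `BSD(E,p)` follows from `MissingPPartOverAt W' p`
ALONE — the twist pair is row C6 (Castella–Grossi–Skinner 2025 Thm. D, `hCGS`, with the GV chain
`hGV`/`hGr`, modularity `hmod`/`hmodP`, GZK), then Milne + descent.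
[cite: CastellaGrossiSkinner2025, Thm. D (= 'Thm. 4')] -/
theorem bsdp_of_classX3_of_goodOrd_twist_of_not_anom
    (hCGS : CastellaGrossiSkinner2025.thmD_padicValRat_bsd_rank_le_one)
    (hGV : GreenbergVatsal2000.thm13_charIdeal_eq_of_gvPar) (hGr : greenberg_charValue_rankZero)
    (hmod : hasEntireLFunction_rat) (hmodP : nonempty_modularParametrizationData)
    (hGZK : rank_eq_analyticRank_of_analyticRank_le_one)
    (hMilne : Milne1972.bsdQuotient_baseChange_quadratic)
    (hX : ClassX3 W p) (hp2 : p ≠ 2) (hr : W.analyticRank ≤ 1)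
    (h2 : Module.finrank ℚ K = 2) (hdK : (NumberField.discr K : ℚ) = (-1 : ℚ) ^ (p / 2) * p)
    (hWd : ∃ C : VariableChange ℚ, C • W.quadraticTwist (NumberField.discr K : ℚ) = Wd)
    (hord : GoodOrd Wd p) (hna : ¬ Anom Wd p) (hrd : Wd.analyticRank ≤ 1)
    (hW' : ∃ C : VariableChange K, C • W.baseChange K = W') (hK : MissingPPartOverAt W' p) :
    BSDp W p := by
  have hWd' : ∃ C : VariableChange ℚ, C • W.quadraticTwist ((-1 : ℚ) ^ (p / 2) * p) = Wd := by
    rw [← hdK]; exact hWd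
  have hp2' : 2 < p := by
    have := hp.out.two_le
    omega
  obtain ⟨hred, -⟩ := red_goodOrd_twist_of_classX3 W p Wd hX hWd' hord
  have hC6 : RowC6 Wd p := ⟨hp2', hred, hord.1, hna⟩
  have hd : BSDp Wd p := RowC6.bsdp hCGS hGV hGr hmod hmodP hGZK hrd hC6
  exact bsdp_of_pPartOver_of_bsdp_twist' W p K Wd W' hGZK hmod hMilne hr h2 hWd hrd hW' hK hd

/-- **X3♯(G-ord), defect 2, twist of analytic rank `0` with the Greenberg–Vatsal parity condition —
conversion to the over-`K` input ALONE.** For `(E,p) ∈ X3` non-CM of analytic rank `≤ 1`, `p` odd,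
`K = ℚ(√p*)`, `Wd` a globally minimal model of `E^{(p*)}` good ordinary at `p` with `L(E^{(p*)},1) ≠ 0`
(`r_an = 0`) and `GVPar Wd p`, and `W'` a globally minimal `K`-model of `E_K`: `BSD(E,p)` follows
from `MissingPPartOverAt W' p` ALONE — the twist pair is row C7 (Greenberg–Vatsal 2000 Thm. 1.3 +
Greenberg 1999 + Kato, `hGV`/`hGr`). [cite: GreenbergVatsal2000, Thm. 1.3] -/
theorem bsdp_of_classX3_of_goodOrd_twist_of_gvPar
    (hGV : GreenbergVatsal2000.thm13_charIdeal_eq_of_gvPar) (hGr : greenberg_charValue_rankZero)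
    (hmod : hasEntireLFunction_rat) (hmodP : nonempty_modularParametrizationData)
    (hGZK : rank_eq_analyticRank_of_analyticRank_le_one)
    (hMilne : Milne1972.bsdQuotient_baseChange_quadratic)
    (hX : ClassX3 W p) (hp2 : p ≠ 2) (hcm : ¬ W.HasCM) (hr : W.analyticRank ≤ 1)
    (h2 : Module.finrank ℚ K = 2) (hdK : (NumberField.discr K : ℚ) = (-1 : ℚ) ^ (p / 2) * p)
    (hWd : ∃ C : VariableChange ℚ, C • W.quadraticTwist (NumberField.discr K : ℚ) = Wd)
    (hord : GoodOrd Wd p) (hr0 : Wd.analyticRank = 0) (hgv : GVPar Wd p)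
    (hW' : ∃ C : VariableChange K, C • W.baseChange K = W') (hK : MissingPPartOverAt W' p) :
    BSDp W p := by
  have hWd' : ∃ C : VariableChange ℚ, C • W.quadraticTwist ((-1 : ℚ) ^ (p / 2) * p) = Wd := by
    rw [← hdK]; exact hWd
  obtain ⟨hred, -⟩ := red_goodOrd_twist_of_classX3 W p Wd hX hWd' hord
  have hcmd : ¬ Wd.HasCM := fun h => hcm ((hasCM_iff_of_model_twist (pStar_ne_zero p) hWd').mp h)
  have hC7 : RowC7 Wd p := ⟨hr0, hcmd, hp2, hord, hred, hgv⟩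
  have hd : BSDp Wd p := RowC7.bsdp hGV hGr hmod hmodP hGZK hC7
  exact bsdp_of_pPartOver_of_bsdp_twist' W p K Wd W' hGZK hmod hMilne hr h2 hWd
    (by rw [hr0]; exact zero_le_one) hW' hK hd

/-- **X3♯(G-ord), defect 2, twist pair of class X1 — relocation to X1 + over-`K`.** For
`(E,p) ∈ X3` of analytic rank `≤ 1`, `K = ℚ(√p*)`, `Wd` a globally minimal model of `E^{(p*)}` of
analytic rank `≤ 1` whose pair `(Wd,p)` is of class X1 (odd GOOD anomalous Eisenstein prime; by
`covered_or_classX1_twist_of_classX3` the only non-covered case), and `W'` a globally minimal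
`K`-model of `E_K`: `BSD(E,p)` follows from `MissingPPartOverAt W' p` AND the cell's typed X1 input
`Typed.X1.MissingInputAt Wd p` (rank 0: the lower bound — Wuthrich Prop. 21 `hW` gives the upper;
rank 1: the whole `p`-part; Keller–Yin announced). Two typed inputs (one construction-shaped, one
combination-shaped): an honest RELOCATION, no deletion. [cite: Wuthrich2014, Prop. 21 (p. 400)] -/
theorem bsdp_of_classX3_of_goodOrd_twist_of_classX1 (hW : sha_dvd_analyticSha)
    (hGZK : rank_eq_analyticRank_of_analyticRank_le_one) (hmod : hasEntireLFunction_rat)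
    (hMilne : Milne1972.bsdQuotient_baseChange_quadratic)
    (_hX : ClassX3 W p) (hr : W.analyticRank ≤ 1) (h2 : Module.finrank ℚ K = 2)
    (hWd : ∃ C : VariableChange ℚ, C • W.quadraticTwist (NumberField.discr K : ℚ) = Wd)
    (hrd : Wd.analyticRank ≤ 1) (hX1 : ClassX1 Wd p) (hmiss : X1.MissingInputAt Wd p)
    (hW' : ∃ C : VariableChange K, C • W.baseChange K = W') (hK : MissingPPartOverAt W' p) :
    BSDp W p :=
  bsdp_of_pPartOver_of_bsdp_twist' W p K Wd W' hGZK hmod hMilne hr h2 hWd hrd hW' hK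
    (X1.bsdp_of_missingInputAt hW hGZK hmod Wd p hrd hX1 hmiss)

end Summit.BirchSwinnertonDyer.Rank1Residual.Additive

end
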